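import Mathlib
import Summits.QuantumFields.BalabanUV.Beta.UnitLatticeWalkInversion

/-!
# `Summit.QuantumFields.BalabanUV.Beta.UnitLatticeWalkTerms` — A3-loc (i): the generalized-random-walk TERMS of the
# unit-lattice walk inversion — `Ptot·Remⁿ = Σ_{b⃗ : Fin (n+1) → cubes} walkTerm b⃗`,
# `walkTerm b⃗ = (H_{b₀}L_{b₀}H_{b₀})·Π_{i≥1}([H_{b_i},K′]L_{b_i}H_{b_i})` (ordered product over a CUBE SEQUENCE), their
# row∕column supports, and the per-term budget `WRS κ d (walkTerm b⃗) ≤ C_L·(K₁C_L/M)ⁿ`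

HONEST FRAMING (page 1 of everything in this cell).  Discharging `FlowStep.BetaPertH` would make
Bałaban's ultraviolet stability UNCONDITIONAL — a constructive-QFT result; it is NOT the continuum
limit and NOT the Clay problem.  This module discharges nothing of `BetaPertH`; [folklore] algebra,
kernel-checked (unit `b2b-balaban-beta-d4-p3`, road P3 «reduction road», gen 3; leaf A3-loc (i) of the skeleton
`beta/skeletons/D4-b2b-balaban-beta-d4-p3.md` v1.7 §7.4 = the first piece of the owner's rider (ρ3) «recombination as
ONE walk expansion with U-localization»: the terms over which the decoration region `dec(γ)` and the U-locality are
defined).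
HONEST DEPENDENCY: continuum YM on T⁴ ⇐ BetaPertH ∧ nine spine estimates (0/9 proved); BetaPertH ⇐
(D1) ∧ (D4) ∧ CAP+tail; G-an2-4 gates asym, D1 and NE2/3/4.

CONTENTS (0 sorry).
* §1 `headFactor b = H_bL_bH_b`, `stepFactor b = (H_bK′ − K′H_b)L_bH_b`, `Ptot = Σ_b headFactor b`, `Rem = Σ_b stepFactor b`;
  `walkTerm n b⃗` by recursion on the cube sequence (`Fin.init`, `Fin.last`); **`Ptot_mul_Rem_pow`**:
  `Ptot·Remⁿ = Σ_{b⃗ : Fin (n+1) → B} walkTerm n b⃗` (induction; `Fin.snocEquiv` re-indexing) — so the walk expansion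
  `UnitLatticeWalkInversion.inv_one_add_eq_sum` is a sum over CUBE SEQUENCES of explicit ordered products of LOCAL
  factors;
* §2 supports: `walkTerm n b⃗ i j = 0` unless `i ∈ □̃_{b₀}` (`walkTerm_apply_eq_zero_of_row`) and `j ∈ □̃_{b_n}`
  (`walkTerm_apply_eq_zero_of_col`) — the term lives between its first and last cube;
* §3 budgets: `wrs_headFactor` (≤ C_L), `wrs_stepFactor` (≤ (K₁/M)·C_L — the commutator's Lipschitz gain, ONE cube, no
  overlap count), `wrs_walkTerm` (≤ C_L·((K₁/M)·C_L)ⁿ, `WRS.mul` BY NAME).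
NOT HERE: the near∕far splitting of the local inverses (A3-loc (ii)), the decoration region and the tube count (iii),
the decorated sum (iv); any instance.  NOT summit progress.
-/

open scoped BigOperators Matrix
open Finset Matrix

namespace Summit.QuantumFields.BalabanUV.Beta.UnitLatticeWalkTerms

open Summit.QuantumFields.BalabanUV.Beta.UnitLatticeWalkInversion
open Literature.MathematicalPhysics.QuantumFieldTheory.Balaban1983to89.B13PerturbativeStep (wrs WRS WeightHyp wrs_mul_le)

noncomputable section

variable {Y : Type*} [Fintype Y] [DecidableEq Y] {B : Type*}

/-! ## §1 Factors, terms, and the expansion over cube sequences -/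

/-- The HEAD factor `H_bL_bH_b` of a walk term (the parametrix piece at the first cube). [folklore] -/
def headFactor (h : B → Y → ℝ) (L : B → Matrix Y Y ℂ) (b : B) : Matrix Y Y ℂ := Hd h b * L b * Hd h b

/-- The STEP factor `(H_bK′ − K′H_b)L_bH_b` of a walk term (one commutator, one local inverse). [folklore] -/
def stepFactor (h : B → Y → ℝ) (K' : Matrix Y Y ℂ) (L : B → Matrix Y Y ℂ) (b : B) : Matrix Y Y ℂ :=
  (Hd h b * K' - K' * Hd h b) * L b * Hd h b

/-- `Ptot = Σ_b headFactor b`. [folklore] -/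
theorem Ptot_eq_sum [Fintype B] (h : B → Y → ℝ) (L : B → Matrix Y Y ℂ) : Ptot h L = ∑ b, headFactor h L b := rfl

/-- `Rem = Σ_b stepFactor b`. [folklore] -/
theorem Rem_eq_sum [Fintype B] (h : B → Y → ℝ) (K' : Matrix Y Y ℂ) (L : B → Matrix Y Y ℂ) :
    Rem h K' L = ∑ b, stepFactor h K' L b := rfl

/-- The WALK TERM over a cube sequence `b⃗ = (b₀, …, b_n)`: `(H_{b₀}L_{b₀}H_{b₀})·Π_{i=1}^{n}([H_{b_i},K′]L_{b_i}H_{b_i})`,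
by recursion on `n` (split off the last cube). [folklore] -/
def walkTerm (h : B → Y → ℝ) (K' : Matrix Y Y ℂ) (L : B → Matrix Y Y ℂ) : (n : ℕ) → (Fin (n + 1) → B) → Matrix Y Y ℂ
  | 0, b => headFactor h L (b 0)
  | n + 1, b => walkTerm h K' L n (Fin.init b) * stepFactor h K' L (b (Fin.last (n + 1)))

/-- Unfolding at a snoc-extended sequence. [folklore] -/
theorem walkTerm_snoc (h : B → Y → ℝ) (K' : Matrix Y Y ℂ) (L : B → Matrix Y Y ℂ) (n : ℕ) (b : Fin (n + 1) → B)
    (c : B) : walkTerm h K' L (n + 1) (Fin.snoc b c) = walkTerm h K' L n b * stepFactor h K' L c := by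
  rw [walkTerm, Fin.init_snoc, Fin.snoc_last]

/-- **THE EXPANSION OVER CUBE SEQUENCES**: `Ptot·Remⁿ = Σ_{b⃗ : Fin (n+1) → B} walkTerm n b⃗`. [folklore] -/
theorem Ptot_mul_Rem_pow [Fintype B] (h : B → Y → ℝ) (K' : Matrix Y Y ℂ) (L : B → Matrix Y Y ℂ) :
    ∀ n : ℕ, Ptot h L * Rem h K' L ^ n = ∑ b : Fin (n + 1) → B, walkTerm h K' L n b
  | 0 => by
      rw [pow_zero, Matrix.mul_one, Ptot_eq_sum]
      exact (Equiv.sum_comp (Equiv.funUnique (Fin 1) B) (fun b => headFactor h L b)).symm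
  | n + 1 => by
      rw [pow_succ, ← Matrix.mul_assoc, Ptot_mul_Rem_pow h K' L n, Rem_eq_sum, Finset.sum_mul_sum]
      -- re-index pairs (b⃗, c) as snoc-extended sequences
      rw [← Equiv.sum_comp (Fin.snocEquiv fun _ => B) (fun b' => walkTerm h K' L (n + 1) b'),
        Fintype.sum_prod_type]
      rw [Finset.sum_comm]
      refine Finset.sum_congr rfl fun c _ => Finset.sum_congr rfl fun b _ => ?_
      exact (walkTerm_snoc h K' L n b c).symm

/-! ## §2 Supports: a walk term lives between its first and its last cube -/

/-- Rows outside `□̃_{b₀}` vanish (the head factor starts with `H_{b₀}`). [folklore] -/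
theorem walkTerm_apply_eq_zero_of_row (h : B → Y → ℝ) (E : B → Finset Y) (hsupp : ∀ b y, y ∉ E b → h b y = 0)
    (K' : Matrix Y Y ℂ) (L : B → Matrix Y Y ℂ) :
    ∀ (n : ℕ) (b : Fin (n + 1) → B) (i j : Y), i ∉ E (b 0) → walkTerm h K' L n b i j = 0
  | 0, b, i, j, hi => by
      simp only [walkTerm, headFactor, Matrix.mul_assoc]
      rw [Hd, Matrix.diagonal_mul, hsupp _ _ hi]
      simp
  | n + 1, b, i, j, hi => by
      rw [walkTerm, Matrix.mul_apply]
      refine Finset.sum_eq_zero fun l _ => ?_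
      have h0 : (Fin.init b) 0 = b 0 := rfl
      rw [walkTerm_apply_eq_zero_of_row h E hsupp K' L n (Fin.init b) i l (h0 ▸ hi), zero_mul]

/-- Columns outside `□̃_{b_n}` vanish (every factor ends with `H_b`). [folklore] -/
theorem walkTerm_apply_eq_zero_of_col (h : B → Y → ℝ) (E : B → Finset Y) (hsupp : ∀ b y, y ∉ E b → h b y = 0)
    (K' : Matrix Y Y ℂ) (L : B → Matrix Y Y ℂ) :
    ∀ (n : ℕ) (b : Fin (n + 1) → B) (i j : Y), j ∉ E (b (Fin.last n)) → walkTerm h K' L n b i j = 0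
  | 0, b, i, j, hj => by
      have hj' : h (b 0) j = 0 := hsupp _ _ hj
      simp only [walkTerm, headFactor]
      rw [Hd, Matrix.mul_diagonal, hj']
      simp
  | n + 1, b, i, j, hj => by
      rw [walkTerm, stepFactor, ← Matrix.mul_assoc, Hd, Matrix.mul_diagonal, hsupp _ _ hj]
      simp

/-! ## §3 Budgets -/

section Budgets

variable {κ : ℝ} {d : Y → Y → ℝ}

/-- `WRS κ d (headFactor b) ≤ C_L`. [folklore] -/
theorem wrs_headFactor (h : B → Y → ℝ) (habs : ∀ b y, |h b y| ≤ 1) (L : B → Matrix Y Y ℂ) {C_L : ℝ}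
    (hL : ∀ b, WRS κ d (L b) C_L) (b : B) : WRS κ d (headFactor h L b) C_L := by
  intro i
  have h1 := wrs_Hd_mul_mul_Hd_le (κ := κ) (d := d) h habs b (L b) i
  have h2 : |h b i| * wrs κ d (L b) i ≤ 1 * C_L :=
    mul_le_mul (habs b i) (hL b i) (wrs_nonneg_aux (L b) i) zero_le_one
  rw [one_mul] at h2
  exact h1.trans h2
where
  /-- nonnegativity of `wrs` (restated locally to avoid an import-order dependence). [folklore] -/
  wrs_nonneg_aux (A : Matrix Y Y ℂ) (i : Y) : 0 ≤ wrs κ d A i :=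
    Finset.sum_nonneg fun j _ => mul_nonneg (norm_nonneg _) (Real.exp_pos _).le

/-- **The step factor's budget**: `WRS κ d (stepFactor b) ≤ (K₁/M)·C_L` — ONE cube: the commutator gains the Lipschitz
factor `d(i,j)/M`, the local inverse costs `C_L`; `K₁` bounds the first exponential moment of `K′`. [folklore] -/
theorem wrs_stepFactor (hw : WeightHyp κ d) (h : B → Y → ℝ) (habs : ∀ b y, |h b y| ≤ 1) {M : ℝ} (hM : 0 < M)
    (hLip : ∀ b y y', |h b y - h b y'| ≤ d y y' / M) (K' : Matrix Y Y ℂ) (L : B → Matrix Y Y ℂ) {C_L K₁ : ℝ}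
    (hC : 0 ≤ C_L) (hL : ∀ b, WRS κ d (L b) C_L) (hK₁ : ∀ i, ∑ j, ‖K' i j‖ * d i j * Real.exp (κ * d i j) ≤ K₁)
    (b : B) : WRS κ d (stepFactor h K' L b) (K₁ / M * C_L) := by
  intro i
  rw [stepFactor, Matrix.mul_assoc]
  refine (wrs_mul_le hw _ _ i).trans ?_
  have hB : ∀ j, wrs κ d (L b * Hd h b) j ≤ C_L := fun j => (wrs_mul_Hd_le h habs b (L b) j).trans (hL b j)
  calc ∑ j, ‖(Hd h b * K' - K' * Hd h b) i j‖ * Real.exp (κ * d i j) * wrs κ d (L b * Hd h b) j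
      ≤ ∑ j, (d i j / M * ‖K' i j‖) * Real.exp (κ * d i j) * C_L := by
        refine Finset.sum_le_sum fun j _ => ?_
        have hA : ‖(Hd h b * K' - K' * Hd h b) i j‖ ≤ d i j / M * ‖K' i j‖ := by
          rw [comm_apply, norm_mul, ← Complex.ofReal_sub, Complex.norm_real, Real.norm_eq_abs]
          exact mul_le_mul_of_nonneg_right (hLip b i j) (norm_nonneg _)
        have hwn : 0 ≤ wrs κ d (L b * Hd h b) j :=
          Finset.sum_nonneg fun l _ => mul_nonneg (norm_nonneg _) (Real.exp_pos _).le
        calc ‖(Hd h b * K' - K' * Hd h b) i j‖ * Real.exp (κ * d i j) * wrs κ d (L b * Hd h b) j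
            ≤ (d i j / M * ‖K' i j‖) * Real.exp (κ * d i j) * wrs κ d (L b * Hd h b) j := by
              gcongr
          _ ≤ (d i j / M * ‖K' i j‖) * Real.exp (κ * d i j) * C_L :=
              mul_le_mul_of_nonneg_left (hB j)
                (mul_nonneg (mul_nonneg (div_nonneg (hw.nonneg i j) hM.le) (norm_nonneg _)) (Real.exp_pos _).le)
    _ = C_L / M * ∑ j, ‖K' i j‖ * d i j * Real.exp (κ * d i j) := by
        rw [Finset.mul_sum]
        refine Finset.sum_congr rfl fun j _ => ?_
        ring
    _ ≤ C_L / M * K₁ := mul_le_mul_of_nonneg_left (hK₁ i) (div_nonneg hC hM.le)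
    _ = K₁ / M * C_L := by ring

/-- **Per-term budget**: `WRS κ d (walkTerm n b⃗) ≤ C_L·((K₁/M)·C_L)ⁿ` (`WRS.mul` BY NAME). [folklore] -/
theorem wrs_walkTerm (hw : WeightHyp κ d) (h : B → Y → ℝ) (habs : ∀ b y, |h b y| ≤ 1) {M : ℝ} (hM : 0 < M)
    (hLip : ∀ b y y', |h b y - h b y'| ≤ d y y' / M) (K' : Matrix Y Y ℂ) (L : B → Matrix Y Y ℂ) {C_L K₁ : ℝ}
    (hC : 0 ≤ C_L) (hL : ∀ b, WRS κ d (L b) C_L) (hK₁ : ∀ i, ∑ j, ‖K' i j‖ * d i j * Real.exp (κ * d i j) ≤ K₁) :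
    ∀ (n : ℕ) (b : Fin (n + 1) → B), WRS κ d (walkTerm h K' L n b) (C_L * (K₁ / M * C_L) ^ n)
  | 0, b => by
      rw [pow_zero, mul_one]
      exact wrs_headFactor h habs L hL (b 0)
  | n + 1, b => by
      rw [walkTerm, pow_succ, ← mul_assoc]
      exact (wrs_walkTerm hw h habs hM hLip K' L hC hL hK₁ n (Fin.init b)).mul hw
        (wrs_stepFactor hw h habs hM hLip K' L hC hL hK₁ _)

end Budgets

end

end Summit.QuantumFields.BalabanUV.Beta.UnitLatticeWalkTerms
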